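import Mathlib.Analysis.SpecialFunctions.Log.Basic
import Mathlib.Analysis.SpecialFunctions.Sqrt
import Mathlib.Algebra.BigOperators.Ring.Finset
import Mathlib.Algebra.Order.BigOperators.Ring.Finset
import Literature.ComputerArithmetic.ConnollyHighamMary2021.ProbabilisticBounds
import Literature.ComputerArithmetic.ElararEtAl2026.HornerPairwise
import HarnessLib

/-!
# El Arar–Sohier–de Oliveira Castro–Petit 2023: variance bounds and Bienaymé–Chebyshev / Azuma–Hoeffding
# probabilistic bounds for the inner product and Horner's rule under SR-nearness

HONEST FRAMING: certified error envelopes and provably optimal rounding/accumulation schemes for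
low-precision formats under stated cost models; every table by two implementations; no hardware or
vendor claims.

Source: E.-M. El Arar, D. Sohier, P. de Oliveira Castro, E. Petit, *Stochastic rounding variance and
probabilistic bounds: a new approach*, SIAM J. Sci. Comput. 45(5) (2023) C255–C275
[cite: ArarEtAl2023]; statements read from arXiv:2207.10321 (pp. 5–8, 12–14 of the preprint).
This file types the results that `ConnollyHighamMary2021.ProbabilisticBounds` lists as "NOT here"
(Theorems 3.2 / 3.5 with condition numbers) plus Lemma 3.1(2) and the §4 probabilistic bounds; the
one-rounding variance identity of §3 (`V(x̂) = ε(x)² θ(x)(1 − θ(x)) ≤ x²u²/4`) is already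
`ConnollyHighamMary2021.srVar_eq` / `srVar_le`, and Lemma 3.1(1),(3) are `productMeanOne` /
`productVarianceBound` there.

* §3.1, the computed inner product (display before Thm. 3.2): with `δ₀ = 0`, `ŝ₁ = a₁b₁(1+δ₁)`,
  `ŝᵢ = (ŝᵢ₋₁ + aᵢbᵢ(1+δ_{2i−2}))(1+δ_{2i−1})`, hence `ŷ = Σ_{i=1}^{n} aᵢbᵢ(1+δ_{2i−2}) ∏_{k=i}^{n}(1+δ_{2k−1})`
  — `ipComputed` (the convention `δ₀ = 0` is `withZero`).
* **Lemma 3.1(2)** (covariance of two error products, under the ordering hypothesis that every index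
  of `K △ K'` precedes every index of `K ∩ K'`): `0 ≤ Cov(ψ_K, ψ_{K'}) ≤ γ_m(u²)`, `m = |K ∩ K'|`
  — NAMED FACT `productCovarianceBound` (with `E ψ = 1`, `Cov = E(ψ_K ψ_{K'}) − 1`).
* **Theorem 3.2** (inner product): `E ŷ = y` and `V(ŷ) ≤ y² K₁² γ_n(u²)`, `K₁ = Σ|aᵢbᵢ|/|Σaᵢbᵢ|`; we state
  the multiplied-out form `E(ŷ − y)² ≤ (Σ|aᵢbᵢ|)² γ_n(u²)` (the same inequality since `E ŷ = y`, and it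
  needs no `y ≠ 0`) — NAMED FACTS `innerProductUnbiased`, `innerProductVarianceBound`.
* **Theorem 3.5** (Horner, Model 3.4: `r̂_{2n} = Σ_{i=0}^{n} aᵢxⁱ ∏_{k=2(n−i)}^{2n}(1+δ_k)`, `δ₀ = 0`, the
  expression `ElararEtAl2026.hornerComputed`): `E r̂_{2n} = P(x)`, `V ≤ P(x)² K₁² γ_{2n}(u²)` —
  NAMED FACTS `hornerUnbiased`, `hornerVarianceBound` (multiplied-out).
* **§4.2, eq. (4.4) / (4.5)** (Bienaymé–Chebyshev): with probability at least `1 − λ`,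
  `|ŷ − y| ≤ (Σ|aᵢbᵢ|)√(γ_n(u²)/λ)` and `|P̂(x) − P(x)| ≤ (Σ|aᵢxⁱ|)√(γ_{2n}(u²)/λ)` — NAMED FACTS
  `innerProductBoundBC`, `hornerBoundBC`.
* **Theorem 4.5** (Horner, Azuma–Hoeffding): with probability at least `1 − λ`,
  `|P̂(x) − P(x)| ≤ (Σ|aᵢxⁱ|)√(u γ_{4n}(u)) √(ln(2/λ))` — NAMED FACT `hornerBoundAH`; PROVED dictionary:
  this envelope is `ElararEtAl2026.hornerEnvelope n u 0 λ` (Theorem 1 of the 2026 paper at `u_{p+r} = 0`).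

All probabilistic statements are over the SR error model `ConnollyHighamMary2021.SRErrorModel μ u δ`
("SR-nearness": `|δ_k| ≤ u`, mean zero, mean independent in index order — Def. 2.1 / Lemma 2.3 of the
source), the error of time step `k` being `δ k`; index `0` is unused by `ipComputed` (the source's
`δ₀ = 0`).  Sanity lemmas (proved) pin the transcriptions down on `n = 0, 1, 2` and `δ ≡ 0`.
-/

namespace Literature.ComputerArithmetic.ElararEtAl2023

open _root_.MeasureTheory
open Finset
open Literature.ComputerArithmetic.ConnollyHighamMary2021 (SRErrorModel gammaSq)
open Literature.ComputerArithmetic.ElararEtAl2026 (gammaFn hornerComputed hornerEnvelope)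

/-! ### The computed inner product of §3.1 -/

/-- The convention `δ₀ = 0` of §3.1 / Model 3.4. [cite: ArarEtAl2023, §3.1] -/
def withZero (δ : ℕ → ℝ) : ℕ → ℝ := fun k => if k = 0 then 0 else δ k

/-- The computed inner product under the standard model, §3.1 (display before Thm. 3.2):
`ŷ = Σ_{i=1}^{n} aᵢ bᵢ (1 + δ_{2i−2}) ∏_{k=i}^{n} (1 + δ_{2k−1})` with `δ₀ = 0` (`δ_{2i−2}`: the product
roundings, `δ_{2k−1}`: the additions, `δ₁`: the first product). [cite: ArarEtAl2023, §3.1] -/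
def ipComputed (n : ℕ) (a b : ℕ → ℝ) (δ : ℕ → ℝ) : ℝ :=
  ∑ i ∈ Icc 1 n, a i * b i * (1 + withZero δ (2 * i - 2)) * ∏ k ∈ Icc i n, (1 + δ (2 * k - 1))

/-! ### Lemma 3.1(2): covariance of two error products -/

/-- **Lemma 3.1(2).** Under SR-nearness, for finite index sets `K, K'` with `|K ∩ K'| = m` such that
every `j ∈ K △ K'` precedes every `k ∈ K ∩ K'`: `0 ≤ Cov(ψ_K, ψ_{K'}) ≤ γ_m(u²)`, where
`ψ_K = ∏_{k∈K}(1 + δ_k)` and (by Lemma 3.1(1)) `Cov(ψ_K, ψ_{K'}) = E(ψ_K ψ_{K'}) − 1`. Named fact.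
[cite: ArarEtAl2023, Lemma 3.1(2)] -/
def productCovarianceBound : Prop :=
  ∀ (Ω : Type) [MeasurableSpace Ω] (μ : Measure Ω) [IsProbabilityMeasure μ] (u : ℝ) (δ : ℕ → Ω → ℝ),
    SRErrorModel μ u δ → ∀ K K' : Finset ℕ, (∀ j ∈ symmDiff K K', ∀ k ∈ K ∩ K', j < k) →
      0 ≤ (∫ ω, (∏ k ∈ K, (1 + δ k ω)) * ∏ k ∈ K', (1 + δ k ω) ∂μ) - 1 ∧
        (∫ ω, (∏ k ∈ K, (1 + δ k ω)) * ∏ k ∈ K', (1 + δ k ω) ∂μ) - 1 ≤ gammaSq (K ∩ K').card u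

/-! ### Theorem 3.2: the inner product -/

/-- **Theorem 3.2, first part:** under SR-nearness `E ŷ = y`. Named fact.
[cite: ArarEtAl2023, Thm. 3.2] -/
def innerProductUnbiased : Prop :=
  ∀ (Ω : Type) [MeasurableSpace Ω] (μ : Measure Ω) [IsProbabilityMeasure μ] (u : ℝ) (δ : ℕ → Ω → ℝ),
    SRErrorModel μ u δ → ∀ (n : ℕ) (a b : ℕ → ℝ),
      ∫ ω, ipComputed n a b (fun k => δ k ω) ∂μ = ∑ i ∈ Icc 1 n, a i * b i

/-- **Theorem 3.2, eq. (3.1):** under SR-nearness `V(ŷ) ≤ y² K₁² γ_n(u²)` with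
`K₁ = Σ|aᵢbᵢ|/|Σaᵢbᵢ|`, i.e. (since `E ŷ = y`) `E(ŷ − y)² ≤ (Σ_{i=1}^{n} |aᵢbᵢ|)² γ_n(u²)`. Named fact,
multiplied-out form. [cite: ArarEtAl2023, Thm. 3.2 eq. (3.1)] -/
def innerProductVarianceBound : Prop :=
  ∀ (Ω : Type) [MeasurableSpace Ω] (μ : Measure Ω) [IsProbabilityMeasure μ] (u : ℝ) (δ : ℕ → Ω → ℝ),
    SRErrorModel μ u δ → ∀ (n : ℕ) (a b : ℕ → ℝ),
      ∫ ω, (ipComputed n a b (fun k => δ k ω) - ∑ i ∈ Icc 1 n, a i * b i) ^ 2 ∂μ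
        ≤ (∑ i ∈ Icc 1 n, |a i * b i|) ^ 2 * gammaSq n u

/-! ### Theorem 3.5: Horner's rule (Model 3.4 = `ElararEtAl2026.hornerComputed`) -/

/-- **Theorem 3.5, first part:** under SR-nearness `E r̂_{2n} = r_{2n} = P(x)`. Named fact.
[cite: ArarEtAl2023, Thm. 3.5] -/
def hornerUnbiased : Prop :=
  ∀ (Ω : Type) [MeasurableSpace Ω] (μ : Measure Ω) [IsProbabilityMeasure μ] (u : ℝ) (δ : ℕ → Ω → ℝ),
    SRErrorModel μ u δ → ∀ (n : ℕ) (a : ℕ → ℝ) (x : ℝ),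
      ∫ ω, hornerComputed n a x (fun k => δ k ω) ∂μ = ∑ i ∈ range (n + 1), a i * x ^ i

/-- **Theorem 3.5, eq. (3.2):** under SR-nearness `V(r̂_{2n}) ≤ r_{2n}² K₁² γ_{2n}(u²)`,
`K₁ = Σ|aᵢxⁱ|/|P(x)|`, i.e. `E(P̂(x) − P(x))² ≤ (Σ_{i=0}^{n} |aᵢxⁱ|)² γ_{2n}(u²)`. Named fact,
multiplied-out form. [cite: ArarEtAl2023, Thm. 3.5 eq. (3.2)] -/
def hornerVarianceBound : Prop :=
  ∀ (Ω : Type) [MeasurableSpace Ω] (μ : Measure Ω) [IsProbabilityMeasure μ] (u : ℝ) (δ : ℕ → Ω → ℝ),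
    SRErrorModel μ u δ → ∀ (n : ℕ) (a : ℕ → ℝ) (x : ℝ),
      ∫ ω, (hornerComputed n a x (fun k => δ k ω) - ∑ i ∈ range (n + 1), a i * x ^ i) ^ 2 ∂μ
        ≤ (∑ i ∈ range (n + 1), |a i * x ^ i|) ^ 2 * gammaSq (2 * n) u

/-! ### §4.2: Bienaymé–Chebyshev bounds, eqs. (4.4) and (4.5) -/

/-- **Eq. (4.4) (inner product, BC method):** for `0 < λ < 1`,
`|ŷ − y| ≤ (Σ|aᵢbᵢ|) √(γ_n(u²)/λ)` with probability at least `1 − λ` (the source divides by `|y|`).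
Named fact. [cite: ArarEtAl2023, §4.2.1 eq. (4.4)] -/
def innerProductBoundBC : Prop :=
  ∀ (Ω : Type) [MeasurableSpace Ω] (μ : Measure Ω) [IsProbabilityMeasure μ] (u : ℝ) (δ : ℕ → Ω → ℝ),
    SRErrorModel μ u δ → ∀ (n : ℕ) (a b : ℕ → ℝ) (lam : ℝ), 0 < lam → lam < 1 →
      μ {ω | (∑ i ∈ Icc 1 n, |a i * b i|) * Real.sqrt (gammaSq n u / lam)
              < |ipComputed n a b (fun k => δ k ω) - ∑ i ∈ Icc 1 n, a i * b i|}
        ≤ ENNReal.ofReal lam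

/-- **Eq. (4.5) (Horner, BC method):** for `0 < λ < 1`,
`|P̂(x) − P(x)| ≤ (Σ|aᵢxⁱ|) √(γ_{2n}(u²)/λ)` with probability at least `1 − λ`. Named fact.
[cite: ArarEtAl2023, §4.2.2 eq. (4.5)] -/
def hornerBoundBC : Prop :=
  ∀ (Ω : Type) [MeasurableSpace Ω] (μ : Measure Ω) [IsProbabilityMeasure μ] (u : ℝ) (δ : ℕ → Ω → ℝ),
    SRErrorModel μ u δ → ∀ (n : ℕ) (a : ℕ → ℝ) (x lam : ℝ), 0 < lam → lam < 1 →
      μ {ω | (∑ i ∈ range (n + 1), |a i * x ^ i|) * Real.sqrt (gammaSq (2 * n) u / lam)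
              < |hornerComputed n a x (fun k => δ k ω) - ∑ i ∈ range (n + 1), a i * x ^ i|}
        ≤ ENNReal.ofReal lam

/-! ### Theorem 4.5: Horner's rule, Azuma–Hoeffding method -/

/-- The envelope of Theorem 4.5, eq. (4.3), multiplied by `|P(x)|`: `√(u γ_{4n}(u)) √(ln(2/λ))`.
[cite: ArarEtAl2023, Thm. 4.5 eq. (4.3)] -/
noncomputable def hornerEnvelopeAH (n : ℕ) (u lam : ℝ) : ℝ :=
  Real.sqrt (u * gammaFn (4 * n) u) * Real.sqrt (Real.log (2 / lam))

/-- **Theorem 4.5 (Horner, AH method):** under SR-nearness, for `0 < λ < 1`,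
`|P̂(x) − P(x)| ≤ (Σ_{i=0}^{n}|aᵢxⁱ|) √(u γ_{4n}(u)) √(ln(2/λ))` with probability at least `1 − λ`
(the source divides by `|P(x)|` and writes `K₁`). Named fact. [cite: ArarEtAl2023, Thm. 4.5] -/
def hornerBoundAH : Prop :=
  ∀ (Ω : Type) [MeasurableSpace Ω] (μ : Measure Ω) [IsProbabilityMeasure μ] (u : ℝ) (δ : ℕ → Ω → ℝ),
    0 < u → u < 1 → SRErrorModel μ u δ → ∀ (n : ℕ) (a : ℕ → ℝ) (x lam : ℝ), 0 < lam → lam < 1 →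
      μ {ω | (∑ i ∈ range (n + 1), |a i * x ^ i|) * hornerEnvelopeAH n u lam
              < |hornerComputed n a x (fun k => δ k ω) - ∑ i ∈ range (n + 1), a i * x ^ i|}
        ≤ ENNReal.ofReal lam

/-! ### Sanity lemmas (proved): the transcriptions on small cases, and the 2026 dictionary -/

/-- No summand: `ŷ = 0`. [cite: ArarEtAl2023, §3.1] -/
theorem ipComputed_zero (a b : ℕ → ℝ) (δ : ℕ → ℝ) : ipComputed 0 a b δ = 0 := by
  simp [ipComputed]

/-- `ŝ₁ = a₁b₁(1 + δ₁)` (the convention `δ₀ = 0` removes the fictitious product factor).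
[cite: ArarEtAl2023, §3.1] -/
theorem ipComputed_one (a b : ℕ → ℝ) (δ : ℕ → ℝ) : ipComputed 1 a b δ = a 1 * b 1 * (1 + δ 1) := by
  simp [ipComputed, withZero]

/-- `ŝ₂ = (a₁b₁(1 + δ₁) + a₂b₂(1 + δ₂))(1 + δ₃)`, the recursion of §3.1 at `i = 2`.
[cite: ArarEtAl2023, §3.1] -/
theorem ipComputed_two (a b : ℕ → ℝ) (δ : ℕ → ℝ) :
    ipComputed 2 a b δ = (a 1 * b 1 * (1 + δ 1) + a 2 * b 2 * (1 + δ 2)) * (1 + δ 3) := by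
  have h1 : Icc 1 2 = ({1, 2} : Finset ℕ) := by decide
  simp [ipComputed, withZero, h1]
  ring

/-- Without rounding errors the computed inner product is exact. [cite: ArarEtAl2023, §3.1] -/
theorem ipComputed_exact (n : ℕ) (a b : ℕ → ℝ) :
    ipComputed n a b (fun _ => 0) = ∑ i ∈ Icc 1 n, a i * b i := by
  unfold ipComputed withZero
  refine sum_congr rfl fun i _ => ?_
  simp

/-- **Dictionary with the 2026 limited-precision analysis:** the Theorem 4.5 envelope is the
Theorem 1 envelope of El Arar–Fasi–Filip–Mikaitis 2026 at `u_{p+r} = 0` (no limited-precision bias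
term). [cite: ArarEtAl2023, Thm. 4.5; ArarEtAl2026, Thm. 1] -/
theorem hornerEnvelope_zero_eq (n : ℕ) (u lam : ℝ) :
    hornerEnvelope n u 0 lam = hornerEnvelopeAH n u lam := by
  simp [hornerEnvelope, hornerEnvelopeAH]

/-- Hence the 2026 named fact at `u_{p+r} = 0` formally dominates Theorem 4.5's conclusion for any
error model satisfying both hypotheses (pointwise equality of the events). [cite: ArarEtAl2023, Thm. 4.5] -/
theorem hornerBoundAH_event_eq (n : ℕ) (u lam : ℝ) (a : ℕ → ℝ) (x : ℝ) (e : ℕ → ℝ) :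
    ((∑ i ∈ range (n + 1), |a i * x ^ i|) * hornerEnvelope n u 0 lam
        < |hornerComputed n a x e - ∑ i ∈ range (n + 1), a i * x ^ i|) ↔
      ((∑ i ∈ range (n + 1), |a i * x ^ i|) * hornerEnvelopeAH n u lam
        < |hornerComputed n a x e - ∑ i ∈ range (n + 1), a i * x ^ i|) := by
  rw [hornerEnvelope_zero_eq]

end Literature.ComputerArithmetic.ElararEtAl2023
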